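import Mathlib
import Summits.MatrixMultiplication.MatrixMultiplication.Theorems.SnSubsetDichotomyPolynomialSlackKeptSplitC
import Summits.MatrixMultiplication.MatrixMultiplication.Theorems.SnSubsetDichotomyPolynomialSlackTwoDenseMasses
import Summits.MatrixMultiplication.MatrixMultiplication.Theorems.SnSubsetDichotomyPolynomialSlackTwoDenseRowHub
import Summits.MatrixMultiplication.MatrixMultiplication.Theorems.SnSubsetDichotomyPolynomialSlackTwoDenseColHub
import Summits.MatrixMultiplication.MatrixMultiplication.Theorems.SnSubsetDichotomyPolynomialSlackTwoDenseMatching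
import Summits.MatrixMultiplication.MatrixMultiplication.Theorems.SnSubsetDichotomyPolynomialSlackPairHeavyMass
import Summits.MatrixMultiplication.MatrixMultiplication.Theorems.SnSubsetDichotomyPolynomialSlackPairSharpMass
import Summits.MatrixMultiplication.MatrixMultiplication.Theorems.SnSubsetDichotomyPolynomialSlackStubSplit
import Summits.MatrixMultiplication.MatrixMultiplication.Theorems.SnSubsetDichotomyPolynomialSlackStructure
import Literature.Combinatorics.Additive.TPPGroupAlgebra

/-!
# Beyond one half, two dense quotients: the sharp volume bound

Crux `Summit.MatrixMultiplication.MatrixMultiplication.Theses.SnSubsetDichotomy.PolynomialSlack`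
(item `stmt-MatrixMultiplication-8306`), level-one programme, lead c8 ("5/8 step"), line
transport-split-hull, registered stub `volume_le_of_two_dense_sharp`.

With `A = S⁻¹T`, `B = T⁻¹U` dense (`K_A, K_B < 16M`) and `C = U⁻¹S` not (`K_C ≥ 16M`), a parity-pure TPP
triple `S, T, U ⊆ S_n` (`n ≥ 1400000(1+log n)²`, `F = n!√(n!)/N ≤ 8n`, small level-one error) has
`|S||T||U| ≤ 64800·9600²·700000²·(1+log n)^{12}·n·B` for every bound `B` on the TPP volumes of `S_{n-1}`:
`kept_split_C` and `twoDense_masses` give a heavy profile `p_C` of mass `≥ 3/4` (capped by `1 + δ₄` via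
`pair_heavy_mass_sharp`) with tiny collision weight; then a heavy row or column of `p_C` is a hub
(`twoDense_rowHub_volume` / `twoDense_colHub_volume`), and otherwise `twoDense_matching_absurd` applies.
-/

namespace Summit.MatrixMultiplication.MatrixMultiplication.Theorems.PolynomialSlack

open scoped BigOperators
open Literature.Combinatorics.Additive (TripleProductProperty)

-- `Summit.<Summit>.<Problem>` is the tree's mandated summit-side namespace (CONVENTIONS §2); for
-- this single-conjunct summit the two coincide, so each declaration silences `dupNamespace`.
set_option linter.dupNamespace false

/-- `log(96·M) ≤ 5(1 + log n)` for `1 ≤ M ≤ n⁴`, `n ≥ 1` (`96M ≤ 2⁷n⁴`, `7 log 2 < 5`). [folklore] -/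
theorem twoDenseSharp_log96 {n : ℕ} (hn : 1 ≤ n) (M : ℝ) (hM : 1 ≤ M) (hMn : M ≤ (n : ℝ) ^ 4) :
    Real.log (96 * M) ≤ 5 * (1 + Real.log n) := by
  have hn1 : (1 : ℝ) ≤ n := by exact_mod_cast hn
  have hn0 : (0 : ℝ) < n := by linarith
  have hlogn : 0 ≤ Real.log n := Real.log_nonneg hn1
  have hM0 : 0 < M := by linarith
  have hn4 : (0 : ℝ) ≤ (n : ℝ) ^ 4 := by positivity
  have h1 : 96 * M ≤ 128 * (n : ℝ) ^ 4 := by linarith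
  have h2 : Real.log (96 * M) ≤ Real.log (128 * (n : ℝ) ^ 4) := Real.log_le_log (by positivity) h1
  have h3 : Real.log (128 * (n : ℝ) ^ 4) = 7 * Real.log 2 + 4 * Real.log n := by
    rw [Real.log_mul (by norm_num) (by positivity), Real.log_pow, show (128 : ℝ) = 2 ^ 7 by norm_num,
      Real.log_pow]
    push_cast
    ring
  linarith [Real.log_two_lt_d9]

/-- `log(6·f/α) ≤ 5(1 + log n)` when `f/α < 16M`, `1 ≤ M ≤ n⁴` (`6·f/α < 96M`). [folklore] -/
theorem twoDenseSharp_log6 {n : ℕ} (hn : 1 ≤ n) (f α M : ℝ) (hf : 0 < f) (hα : 0 < α) (hM : 1 ≤ M)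
    (hMn : M ≤ (n : ℝ) ^ 4) (hK : f / α < 16 * M) :
    Real.log (6 * f / α) ≤ 5 * (1 + Real.log n) := by
  have h1 : 6 * f / α ≤ 96 * M := by
    rw [mul_div_assoc]; linarith
  have h0 : 0 < 6 * f / α := by positivity
  exact (Real.log_le_log h0 h1).trans (twoDenseSharp_log96 hn M hM hMn)

/-- `log(4n·f/γ) ≤ 6(1 + log n)` when `f/γ ≤ F² ≤ 64n²` (`4n·64n² = 256n³`, `8 log 2 < 6`). [folklore] -/
theorem twoDenseSharp_log256 {n : ℕ} (hn : 1 ≤ n) (f γ F : ℝ) (hf : 0 < f) (hγ : 0 < γ)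
    (hK : f / γ ≤ F ^ 2) (hF : F ≤ 8 * n) (hF0 : 0 ≤ F) :
    Real.log (4 * n * f / γ) ≤ 6 * (1 + Real.log n) := by
  have hn1 : (1 : ℝ) ≤ n := by exact_mod_cast hn
  have hn0 : (0 : ℝ) < n := by linarith
  have hlogn : 0 ≤ Real.log n := Real.log_nonneg hn1
  have hF2 : F ^ 2 ≤ 64 * (n : ℝ) ^ 2 := by
    have h8 : 0 ≤ 8 * (n : ℝ) := by positivity
    calc F ^ 2 = F * F := sq F
      _ ≤ (8 * n) * (8 * n) := mul_le_mul hF hF hF0 h8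
      _ = 64 * (n : ℝ) ^ 2 := by ring
  have h1 : 4 * n * f / γ ≤ 256 * (n : ℝ) ^ 3 := by
    rw [mul_div_assoc]
    have h64 : f / γ ≤ 64 * (n : ℝ) ^ 2 := hK.trans hF2
    have h4 : 0 ≤ 4 * (n : ℝ) := by positivity
    calc 4 * (n : ℝ) * (f / γ) ≤ 4 * n * (64 * (n : ℝ) ^ 2) := mul_le_mul_of_nonneg_left h64 h4
      _ = 256 * (n : ℝ) ^ 3 := by ring
  have h2 : Real.log (4 * n * f / γ) ≤ Real.log (256 * (n : ℝ) ^ 3) :=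
    Real.log_le_log (by positivity) h1
  have h3 : Real.log (256 * (n : ℝ) ^ 3) = 8 * Real.log 2 + 3 * Real.log n := by
    rw [Real.log_mul (by norm_num) (by positivity), Real.log_pow, show (256 : ℝ) = 2 ^ 8 by norm_num,
      Real.log_pow]
    push_cast
    ring
  linarith [Real.log_two_lt_d9]

/-- Co-density bookkeeping: with `K_A = f/α`, `K_B = f/β`, `K_C = f/γ`, `αβγ = N²` and `F = f√f/N` one has
`K_A K_B K_C = F²`; hence `K_C ≤ F²` (as `K_A, K_B ≥ 1`) and `F² ≤ 256M²·K_C` (as `K_A, K_B < 16M`).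
[folklore] -/
theorem twoDenseSharp_codensity (f α β γ N M : ℝ) (hf : 0 < f) (hα : 0 < α) (hβ : 0 < β)
    (hγ : 0 < γ) (hN : 0 < N) (hαle : α ≤ f) (hβle : β ≤ f)
    (hprod : α * β * γ = N ^ 2) (hKA : f / α < 16 * M) (hKB : f / β < 16 * M) :
    f / γ ≤ (f * Real.sqrt f / N) ^ 2 ∧ (f * Real.sqrt f / N) ^ 2 ≤ 256 * M ^ 2 * (f / γ) ∧
      0 < f * Real.sqrt f / N := by
  have hKKK : f / α * (f / β) * (f / γ) = (f * Real.sqrt f / N) ^ 2 := by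
    rw [div_pow, mul_pow, Real.sq_sqrt hf.le, ← hprod]
    field_simp
  have hKA1 : 1 ≤ f / α := by rw [le_div_iff₀ hα]; linarith
  have hKB1 : 1 ≤ f / β := by rw [le_div_iff₀ hβ]; linarith
  have hKC0 : 0 < f / γ := by positivity
  have hKA0 : 0 < f / α := by positivity
  have hKB0 : 0 < f / β := by positivity
  refine ⟨?_, ?_, by positivity⟩
  · rw [← hKKK]
    calc f / γ = 1 * 1 * (f / γ) := by ring
      _ ≤ f / α * (f / β) * (f / γ) := by gcongr
  · rw [← hKKK]
    have h2 : f / α * (f / β) ≤ 16 * M * (16 * M) := (mul_lt_mul'' hKA hKB hKA0.le hKB0.le).le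
    calc f / α * (f / β) * (f / γ) ≤ 16 * M * (16 * M) * (f / γ) :=
          mul_le_mul_of_nonneg_right h2 hKC0.le
      _ = 256 * M ^ 2 * (f / γ) := by ring

/-- The sharp heavy-mass excess of the sparse quotient `C`: if the heavy mass `w` of its profile at level
`θ = n!/(γ·n·M)` satisfies `w ≤ 200(1+log n)·Lg` with `Lg ≤ 6(1+log n)` and the sharp bound
`w ≤ 1 + (w/θ)²(n-2)!/γ`, and `F² ≤ 256M²·(n!/γ)`, then `w ≤ 1 + 256Λ²nM⁴/((n-1)F²)`,
`Λ = 1200(1+log n)²` (using `n! = n(n-1)(n-2)!`). [folklore] -/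
theorem twoDenseSharp_heavy_le {n : ℕ} (hn : 2 ≤ n) (w γ M F Lg θ : ℝ) (hγ : 0 < γ) (hM : 0 < M)
    (hF : 0 < F) (hw0 : 0 ≤ w) (hθ : θ = (n.factorial : ℝ) / (γ * n * M))
    (hmass : w ≤ 200 * (1 + Real.log n) * Lg) (hLg : Lg ≤ 6 * (1 + Real.log n))
    (hsharp : w ≤ 1 + (w / θ) ^ 2 * (n - 2).factorial / γ)
    (hKC : F ^ 2 ≤ 256 * M ^ 2 * ((n.factorial : ℝ) / γ)) :
    w ≤ 1 + 256 * (1200 * (1 + Real.log n) ^ 2) ^ 2 * n * M ^ 4 / (((n : ℝ) - 1) * F ^ 2) := by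
  have hnR : (2 : ℝ) ≤ n := by exact_mod_cast hn
  have hn0 : (0 : ℝ) < n := by linarith
  have hm0 : (0 : ℝ) < (n : ℝ) - 1 := by linarith
  have hf0 : (0 : ℝ) < n.factorial := by exact_mod_cast n.factorial_pos
  have hlogn : 0 ≤ Real.log n := Real.log_nonneg (by linarith)
  have hG0 : 0 ≤ 1 + Real.log n := by linarith
  obtain ⟨Λ, hΛ⟩ : ∃ Λ : ℝ, Λ = 1200 * (1 + Real.log n) ^ 2 := ⟨_, rfl⟩
  rw [← hΛ]
  have hθ0 : 0 < θ := by rw [hθ]; positivity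
  -- `w ≤ Λ`
  have hwΛ : w ≤ Λ := by
    rw [hΛ]
    have h1 : 200 * (1 + Real.log n) * Lg ≤ 200 * (1 + Real.log n) * (6 * (1 + Real.log n)) :=
      mul_le_mul_of_nonneg_left hLg (by positivity)
    linarith
  -- monotonicity of the sharp bound in the mass
  have hmono : (w / θ) ^ 2 * (n - 2).factorial / γ ≤ (Λ / θ) ^ 2 * (n - 2).factorial / γ := by
    apply div_le_div_of_nonneg_right _ hγ.le
    apply mul_le_mul_of_nonneg_right _ (Nat.cast_nonneg _)
    apply pow_le_pow_left₀ (div_nonneg hw0 hθ0.le)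
    exact div_le_div_of_nonneg_right hwΛ hθ0.le
  -- the identity `(Λ/θ)²(n-2)!/γ = Λ² n M²/((n-1) K_C)`
  have hfact : (n.factorial : ℝ) = n * ((n : ℝ) - 1) * ((n - 2).factorial : ℝ) := by
    have h2 : n = (n - 2) + 2 := by omega
    conv_lhs => rw [h2]
    rw [Nat.factorial_succ, Nat.factorial_succ]
    push_cast
    have : (((n - 2 : ℕ) : ℝ)) = (n : ℝ) - 2 := by rw [Nat.cast_sub (by omega)]; norm_num
    rw [this]; ring
  have hexcess : (Λ / θ) ^ 2 * (n - 2).factorial / γ =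
      Λ ^ 2 * n * M ^ 2 / (((n : ℝ) - 1) * ((n.factorial : ℝ) / γ)) := by
    rw [hθ, hfact]
    field_simp
  -- `Λ² n M²/((n-1) K_C) ≤ 256 Λ² n M⁴/((n-1) F²)`
  have hKC0 : 0 < (n.factorial : ℝ) / γ := by positivity
  have hlast : Λ ^ 2 * n * M ^ 2 / (((n : ℝ) - 1) * ((n.factorial : ℝ) / γ)) ≤
      256 * Λ ^ 2 * n * M ^ 4 / (((n : ℝ) - 1) * F ^ 2) := by
    rw [div_le_div_iff₀ (by positivity) (by positivity)]
    have h0 : 0 ≤ Λ ^ 2 * n * M ^ 2 * ((n : ℝ) - 1) := by positivity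
    have h1 := mul_le_mul_of_nonneg_left hKC h0
    calc Λ ^ 2 * n * M ^ 2 * (((n : ℝ) - 1) * F ^ 2) = Λ ^ 2 * n * M ^ 2 * ((n : ℝ) - 1) * F ^ 2 := by
          ring
      _ ≤ Λ ^ 2 * n * M ^ 2 * ((n : ℝ) - 1) * (256 * M ^ 2 * ((n.factorial : ℝ) / γ)) := h1
      _ = 256 * Λ ^ 2 * n * M ^ 4 * (((n : ℝ) - 1) * ((n.factorial : ℝ) / γ)) := by ring
  calc w ≤ 1 + (w / θ) ^ 2 * (n - 2).factorial / γ := hsharp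
    _ ≤ 1 + (Λ / θ) ^ 2 * (n - 2).factorial / γ := by linarith
    _ = 1 + Λ ^ 2 * n * M ^ 2 / (((n : ℝ) - 1) * ((n.factorial : ℝ) / γ)) := by rw [hexcess]
    _ ≤ 1 + 256 * Λ ^ 2 * n * M ^ 4 / (((n : ℝ) - 1) * F ^ 2) := by linarith

/-- The budget of the two-dense case: from the kept identity `1 - δ ≤ ((n-1)/n)W - (n-1)Φ`, the
heavy-mass cap `W ≤ W' ≤ 1 + d₄`, the error bound `δ ≤ dm` and the smallness `dm + d₄ ≤ 1/(5·10¹⁴G⁸)`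
(`G ≥ 1`, `n ≥ 40`): `W ≥ 3/4`, `nΦ ≤ 2η₀` with `η₀ = τ²/(1944G⁴)`, `τ = 1/(700000G²)`, and
`nΦ ≤ 1/512`. [folklore] -/
theorem twoDenseSharp_budget {n : ℕ} (hn : 40 ≤ n) (W W' Φ δ dm d4 G : ℝ) (hG : 1 ≤ G)
    (hW0 : 0 ≤ W) (hΦ0 : 0 ≤ Φ)
    (hi : 1 - δ ≤ ((n : ℝ) - 1) / n * W - ((n : ℝ) - 1) * Φ)
    (hWW : W ≤ W') (hW' : W' ≤ 1 + d4) (hδ : δ ≤ dm) (hd4 : 0 ≤ d4)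
    (hsmall : dm + d4 ≤ 1 / (5 * 10 ^ 14 * G ^ 8)) :
    3 / 4 ≤ W ∧ (n : ℝ) * Φ ≤ 2 * ((1 / (700000 * G ^ 2)) ^ 2 / (1944 * G ^ 4)) ∧
      (n : ℝ) * Φ ≤ 1 / 512 := by
  have hnR : (40 : ℝ) ≤ n := by exact_mod_cast hn
  have hn0 : (0 : ℝ) < n := by linarith
  have hG0 : 0 < G := by linarith
  have hG8 : 1 ≤ G ^ 8 := one_le_pow₀ hG
  have hε : 1 / (5 * 10 ^ 14 * G ^ 8) ≤ 1 / (5 * 10 ^ 14) := by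
    apply div_le_div_of_nonneg_left zero_le_one (by norm_num)
    nlinarith
  have key : ((n : ℝ) - 1) / n * W = W - W / n := by field_simp
  have hWn : 0 ≤ W / n := by positivity
  have hmΦ : 0 ≤ ((n : ℝ) - 1) * Φ := mul_nonneg (by linarith) hΦ0
  -- `(n-1)Φ ≤ dm + d₄`, hence `nΦ ≤ (40/39)(dm + d₄)`
  have h1 : ((n : ℝ) - 1) * Φ ≤ dm + d4 := by linarith
  have h2 : 39 * Φ ≤ dm + d4 := by
    have : 0 ≤ ((n : ℝ) - 40) * Φ := mul_nonneg (by linarith) hΦ0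
    linarith
  have h3 : (n : ℝ) * Φ ≤ 40 / 39 * (dm + d4) := by
    have e : (n : ℝ) * Φ = ((n : ℝ) - 1) * Φ + Φ := by ring
    rw [e]; linarith
  have h4 : (n : ℝ) * Φ ≤ 40 / 39 * (1 / (5 * 10 ^ 14 * G ^ 8)) := h3.trans (by linarith)
  refine ⟨by linarith, ?_, by linarith⟩
  refine h4.trans ?_
  have eq1 : (40 : ℝ) / 39 * (1 / (5 * 10 ^ 14 * G ^ 8)) = 40 / 39 / (5 * 10 ^ 14) / G ^ 8 := by
    field_simp
  have eq2 : (2 : ℝ) * ((1 / (700000 * G ^ 2)) ^ 2 / (1944 * G ^ 4)) =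
      2 / (700000 ^ 2 * 1944) / G ^ 8 := by
    field_simp
  rw [eq1, eq2]
  apply div_le_div_of_nonneg_right _ (by positivity)
  norm_num

/-- `τ·(140000·G·Lm) ≤ 1` for `τ = 1/(700000G²)` and `Lm ≤ 5G`. [folklore] -/
theorem twoDenseSharp_tauM (G Lm : ℝ) (hG : 0 < G) (hLm : Lm ≤ 5 * G) :
    1 / (700000 * G ^ 2) * (140000 * G * Lm) ≤ 1 := by
  rw [show 1 / (700000 * G ^ 2) * (140000 * G * Lm) = Lm / (5 * G) by field_simp; ring]
  rw [div_le_iff₀ (by positivity)]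
  linarith

/-- The closing arithmetic of the hub branches: with `LL = 5G`, `τ = 1/(700000G²)`, `η₀ = τ²/(1944G⁴)`,
`768·(9600²·9⁴)·G^{10}·LL²·η₀·m·b/τ⁴ = 64800·9600²·700000²·G^{12}·m·b`. [folklore] -/
theorem twoDenseSharp_final (N G m b : ℝ) (hG : 0 < G)
    (h : N ≤ 768 * (9600 ^ 2 * 9 ^ 4) * G ^ 10 * (5 * G) ^ 2 *
      ((1 / (700000 * G ^ 2)) ^ 2 / (1944 * G ^ 4)) * m * b / (1 / (700000 * G ^ 2)) ^ 4) :
    N ≤ 64800 * 9600 ^ 2 * 700000 ^ 2 * G ^ 12 * m * b := by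
  refine h.trans_eq ?_
  field_simp
  ring

set_option maxHeartbeats 1600000 in
/-- **Two dense quotients, sharp form.** In the labelling where `A = S⁻¹T` and `B = T⁻¹U` are dense
(`K_A, K_B < 16M`) and `C = U⁻¹S` is not (`K_C ≥ 16M`), a parity-pure TPP triple of non-empty sets with
`1 ≤ M ≤ n⁴`, `n ≥ 1400000(1+log n)²`, `F = n!√(n!)/N ≤ 8n` and the smallness condition `hsmall` on the
explicit level-one error and the sharp heavy-mass excess `256Λ²nM⁴/((n-1)F²)` satisfies
`|S||T||U| ≤ 64800·9600²·700000²·(1+log n)^{12}·n·B` for every bound `B` on the TPP volumes of `S_{n-1}`: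
by the dichotomy "hub row / hub column / scattered matching (absurd)" for the heavy profile of `C`.
[folklore] -/
theorem volume_le_of_two_dense_sharp {n : ℕ} (hn : 40 ≤ n) (B : ℕ)
    (hB : ∀ S' T' U' : Finset (Equiv.Perm (Fin (n - 1))), TripleProductProperty S' T' U' →
      S'.card * T'.card * U'.card ≤ B)
    {S T U : Finset (Equiv.Perm (Fin n))} (hTPP : TripleProductProperty S T U)
    (hS0 : S.Nonempty) (hT0 : T.Nonempty) (hU0 : U.Nonempty)
    (hS : ∀ s ∈ S, ∀ s' ∈ S, Equiv.Perm.sign s = Equiv.Perm.sign s')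
    (hT : ∀ t ∈ T, ∀ t' ∈ T, Equiv.Perm.sign t = Equiv.Perm.sign t')
    (hU : ∀ u ∈ U, ∀ u' ∈ U, Equiv.Perm.sign u = Equiv.Perm.sign u')
    (M : ℝ) (hM : 1 ≤ M) (hMn : M ≤ (n : ℝ) ^ 4)
    (hnG : 1400000 * (1 + Real.log n) ^ 2 ≤ (n : ℝ))
    (hKA : (n.factorial : ℝ) / (S.card * T.card : ℕ) < 16 * M)
    (hKB : (n.factorial : ℝ) / (T.card * U.card : ℕ) < 16 * M)
    (hKC : 16 * M ≤ (n.factorial : ℝ) / (U.card * S.card : ℕ))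
    (hF : (n.factorial : ℝ) * Real.sqrt (n.factorial : ℝ) / (S.card * T.card * U.card : ℕ) ≤ 8 * n)
    (hsmall : (n.factorial : ℝ) * Real.sqrt (n.factorial : ℝ) / (S.card * T.card * U.card : ℕ) *
          (Real.sqrt 6 / Real.sqrt ((n : ℝ) * ((n : ℝ) - 1)) +
            30 * Real.sqrt ((1 + Real.log n) * (6 * (1 + Real.log n)) / M) / Real.sqrt ((n : ℝ) - 1)) +
        256 * (1200 * (1 + Real.log n) ^ 2) ^ 2 * n * M ^ 4 /
          (((n : ℝ) - 1) *
            ((n.factorial : ℝ) * Real.sqrt (n.factorial : ℝ) / (S.card * T.card * U.card : ℕ)) ^ 2) ≤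
        1 / (5 * 10 ^ 14 * (1 + Real.log n) ^ 8)) :
    ((S.card * T.card * U.card : ℕ) : ℝ) ≤
      64800 * 9600 ^ 2 * 700000 ^ 2 * (1 + Real.log n) ^ 12 * n * B := by
  classical
  /- 0. scalars -/
  have hn1 : 1 ≤ n := by omega
  have hn2 : 2 ≤ n := by omega
  have hnR : (40 : ℝ) ≤ n := by exact_mod_cast hn
  have hn0 : (0 : ℝ) < n := by linarith
  have hm0 : (0 : ℝ) < (n : ℝ) - 1 := by linarith
  have hM0 : 0 < M := by linarith
  have hf0 : (0 : ℝ) < n.factorial := by exact_mod_cast n.factorial_pos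
  have hlogn : 0 ≤ Real.log n := Real.log_nonneg (by linarith)
  have hG1 : 1 ≤ 1 + Real.log n := by linarith
  have hG0 : 0 < 1 + Real.log n := by linarith
  have hα0 : (0 : ℝ) < (S.card * T.card : ℕ) := by exact_mod_cast Nat.mul_pos hS0.card_pos hT0.card_pos
  have hβ0 : (0 : ℝ) < (T.card * U.card : ℕ) := by exact_mod_cast Nat.mul_pos hT0.card_pos hU0.card_pos
  have hγ0 : (0 : ℝ) < (U.card * S.card : ℕ) := by exact_mod_cast Nat.mul_pos hU0.card_pos hS0.card_pos
  have hN0 : (0 : ℝ) < (S.card * T.card * U.card : ℕ) := by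
    exact_mod_cast Nat.mul_pos (Nat.mul_pos hS0.card_pos hT0.card_pos) hU0.card_pos
  have hprod : ((S.card * T.card : ℕ) : ℝ) * (T.card * U.card : ℕ) * (U.card * S.card : ℕ) =
      ((S.card * T.card * U.card : ℕ) : ℝ) ^ 2 := by
    push_cast; ring
  /- 1. injectivity of the quotient maps, packing, co-densities and the pair logarithms -/
  have hinjA := injOn_quot_first hTPP hU0
  have hinjB := injOn_quot_second hTPP hS0
  have hinjC := injOn_quot_first hTPP.rotate.rotate hT0
  have hαle : ((S.card * T.card : ℕ) : ℝ) ≤ n.factorial := by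
    exact_mod_cast card_mul_card_le_factorial_of_injOn hinjA
  have hβle : ((T.card * U.card : ℕ) : ℝ) ≤ n.factorial := by
    exact_mod_cast card_mul_card_le_factorial_of_injOn hinjB
  obtain ⟨hKCF, hFKC, hF0⟩ := twoDenseSharp_codensity (n.factorial : ℝ) ((S.card * T.card : ℕ) : ℝ)
    ((T.card * U.card : ℕ) : ℝ) ((U.card * S.card : ℕ) : ℝ) ((S.card * T.card * U.card : ℕ) : ℝ) M
    hf0 hα0 hβ0 hγ0 hN0 hαle hβle hprod hKA hKB
  have hLC : Real.log (4 * n * n.factorial / (U.card * S.card : ℕ)) ≤ 6 * (1 + Real.log n) :=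
    twoDenseSharp_log256 hn1 _ _ _ hf0 hγ0 hKCF hF hF0.le
  have hLA : Real.log (6 * n.factorial / (S.card * T.card : ℕ)) ≤ 5 * (1 + Real.log n) :=
    twoDenseSharp_log6 hn1 _ _ M hf0 hα0 hM hMn hKA
  have hLB : Real.log (6 * n.factorial / (T.card * U.card : ℕ)) ≤ 5 * (1 + Real.log n) :=
    twoDenseSharp_log6 hn1 _ _ M hf0 hβ0 hM hMn hKB
  have hL96 : Real.log (96 * M) ≤ 5 * (1 + Real.log n) := twoDenseSharp_log96 hn1 M hM hMn
  have hL1 : 1 ≤ 6 * (1 + Real.log n) := by linarith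
  /- 2. the threshold, the profiles and the heavy part of `C` -/
  have hθC16 : 16 / (n : ℝ) ≤ (n.factorial : ℝ) / ((U.card * S.card : ℕ) * n * M) := by
    rw [div_le_div_iff₀ hn0 (by positivity)]
    have h := hKC
    rw [le_div_iff₀ hγ0] at h
    linarith [mul_le_mul_of_nonneg_right h hn0.le]
  have hθC0 : 0 < (n.factorial : ℝ) / ((U.card * S.card : ℕ) * n * M) := by positivity
  set dA : Fin n → Fin n → ℝ := fun i j =>
    (((S ×ˢ T).filter fun st => st.2 j = st.1 i).card : ℝ) / (S.card * T.card : ℕ) with hdA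
  set dB : Fin n → Fin n → ℝ := fun j k =>
    (((T ×ˢ U).filter fun tu => tu.2 k = tu.1 j).card : ℝ) / (T.card * U.card : ℕ) with hdB
  set dC : Fin n → Fin n → ℝ := fun k i =>
    (((U ×ˢ S).filter fun us => us.2 i = us.1 k).card : ℝ) / (U.card * S.card : ℕ) with hdC
  set pC : Fin n → Fin n → ℝ := fun k i =>
    if (n.factorial : ℝ) / ((U.card * S.card : ℕ) * n * M) ≤ dC k i then dC k i - 1 / n else 0 with hpC
  /- 3. the kept inequality and the masses -/
  have hkept := kept_split_C hn hTPP hS0 hT0 hU0 hS hT hU dA dB dC pC (fun _ _ => rfl)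
    (fun _ _ => rfl) (fun _ _ => rfl) M (6 * (1 + Real.log n)) hM hL1 hKC hLC (fun _ _ => rfl)
  obtain ⟨hi, -, hp0, hpd, -, hdA0, hdB0, hdC0, -, -, -⟩ := twoDense_masses hn2 hS0 hT0 hU0 dA dB dC pC
    (fun _ _ => rfl) (fun _ _ => rfl) (fun _ _ => rfl)
    ((n.factorial : ℝ) / ((U.card * S.card : ℕ) * n * M)) _ hθC16 (fun _ _ => rfl) hkept
  /- 4. the heavy mass of `C` is at most `1 + δ₄` -/
  have hW'le : ∑ k : Fin n, ∑ i : Fin n, pC k i ≤ ∑ k : Fin n, ∑ i : Fin n,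
      (if (n.factorial : ℝ) / ((U.card * S.card : ℕ) * n * M) ≤ dC k i then dC k i else 0) := by
    refine Finset.sum_le_sum fun k _ => Finset.sum_le_sum fun i _ => ?_
    show (if (n.factorial : ℝ) / ((U.card * S.card : ℕ) * n * M) ≤ dC k i then dC k i - 1 / (n : ℝ)
      else 0) ≤ _
    split_ifs with h
    · linarith [show 0 ≤ 1 / (n : ℝ) by positivity]
    · exact le_rfl
  have hW'0 : 0 ≤ ∑ k : Fin n, ∑ i : Fin n,
      (if (n.factorial : ℝ) / ((U.card * S.card : ℕ) * n * M) ≤ dC k i then dC k i else 0) :=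
    Finset.sum_nonneg fun k _ => Finset.sum_nonneg fun i _ => by
      split_ifs
      · exact hdC0 k i
      · exact le_rfl
  have hmass := pair_heavy_mass hn1 U S hU0 hS0 hinjC dC (fun _ _ => rfl)
    ((n.factorial : ℝ) / ((U.card * S.card : ℕ) * n * M)) hθC16
  have hsharp := pair_heavy_mass_sharp U S hU0 hS0 hinjC dC (fun _ _ => rfl)
    ((n.factorial : ℝ) / ((U.card * S.card : ℕ) * n * M)) hθC0
  have hheavy := twoDenseSharp_heavy_le hn2 _ _ M _ _ _ hγ0 hM0 hF0 hW'0 rfl hmass hLC hsharp hFKC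
  /- 5. the budget: `W ≥ 3/4` and `nΦ` tiny -/
  have herr := levelOneError_le hn2 ((S.card * T.card * U.card : ℕ) : ℝ) (1 + Real.log n)
    (6 * (1 + Real.log n)) M hN0
  have hW0 : 0 ≤ ∑ k : Fin n, ∑ i : Fin n, pC k i :=
    Finset.sum_nonneg fun k _ => Finset.sum_nonneg fun i _ => hp0 k i
  have hΦ0 : 0 ≤ ∑ k : Fin n, ∑ i : Fin n, pC k i * ∑ j : Fin n, dA i j * dB j k :=
    Finset.sum_nonneg fun k _ => Finset.sum_nonneg fun i _ => mul_nonneg (hp0 k i)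
      (Finset.sum_nonneg fun j _ => mul_nonneg (hdA0 i j) (hdB0 j k))
  have hd40 : 0 ≤ 256 * (1200 * (1 + Real.log n) ^ 2) ^ 2 * n * M ^ 4 / (((n : ℝ) - 1) *
      ((n.factorial : ℝ) * Real.sqrt (n.factorial : ℝ) / (S.card * T.card * U.card : ℕ)) ^ 2) := by
    positivity
  obtain ⟨hW34, hΦη, hΦ512⟩ := twoDenseSharp_budget hn _ _ _ _ _ _ (1 + Real.log n) hG1 hW0 hΦ0 hi
    hW'le hheavy herr hd40 hsmall
  /- 6. parameters of the dichotomy -/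
  have hτ : 2 / (n : ℝ) ≤ 1 / (700000 * (1 + Real.log n) ^ 2) := by
    rw [div_le_div_iff₀ hn0 (by positivity)]
    linarith
  have hτ0 : (0 : ℝ) < 1 / (700000 * (1 + Real.log n) ^ 2) := by positivity
  have hη₀ : (0 : ℝ) < (1 / (700000 * (1 + Real.log n) ^ 2)) ^ 2 / (1944 * (1 + Real.log n) ^ 4) := by
    positivity
  have hηq : 1944 * (1 + Real.log n) ^ 4 *
      ((1 / (700000 * (1 + Real.log n) ^ 2)) ^ 2 / (1944 * (1 + Real.log n) ^ 4)) ≤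
      (1 / (700000 * (1 + Real.log n) ^ 2)) ^ 2 := by
    rw [mul_div_cancel₀ _ (by positivity)]
  have hτM : 1 / (700000 * (1 + Real.log n) ^ 2) * (140000 * (1 + Real.log n) * Real.log (96 * M)) ≤ 1 :=
    twoDenseSharp_tauM _ _ hG0 hL96
  have hΦ' : ∑ k : Fin n, ∑ i : Fin n, pC k i * ((n : ℝ) * ∑ j : Fin n, dA i j * dB j k) ≤ 1 / 512 := by
    have e : ∑ k : Fin n, ∑ i : Fin n, pC k i * ((n : ℝ) * ∑ j : Fin n, dA i j * dB j k) =
        (n : ℝ) * ∑ k : Fin n, ∑ i : Fin n, pC k i * ∑ j : Fin n, dA i j * dB j k := by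
      rw [Finset.mul_sum]
      refine Finset.sum_congr rfl fun k _ => ?_
      rw [Finset.mul_sum]
      exact Finset.sum_congr rfl fun i _ => by ring
    rw [e]; exact hΦ512
  /- 7. the dichotomy: hub row, hub column, or a scattered matching (absurd) -/
  by_cases hrow : ∃ k : Fin n, 1 / (700000 * (1 + Real.log n) ^ 2) ≤ ∑ i : Fin n, pC k i
  · have h := twoDense_rowHub_volume hn2 B hB hTPP hS0 hT0 hU0 dA dB dC pC (fun _ _ => rfl)
      (fun _ _ => rfl) (fun _ _ => rfl) ((n.factorial : ℝ) / ((U.card * S.card : ℕ) * n * M)) hθC16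
      (fun _ _ => rfl) (5 * (1 + Real.log n)) (1 / (700000 * (1 + Real.log n) ^ 2))
      ((1 / (700000 * (1 + Real.log n) ^ 2)) ^ 2 / (1944 * (1 + Real.log n) ^ 4)) hτ hη₀ hLA hΦη hηq
      hrow
    exact twoDenseSharp_final _ _ _ _ hG0 h
  · by_cases hcol : ∃ i : Fin n, 1 / (700000 * (1 + Real.log n) ^ 2) ≤ ∑ k : Fin n, pC k i
    · have h := twoDense_colHub_volume hn2 B hB hTPP hS0 hT0 hU0 dA dB dC pC (fun _ _ => rfl)
        (fun _ _ => rfl) (fun _ _ => rfl) ((n.factorial : ℝ) / ((U.card * S.card : ℕ) * n * M)) hθC16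
        (fun _ _ => rfl) (5 * (1 + Real.log n)) (1 / (700000 * (1 + Real.log n) ^ 2))
        ((1 / (700000 * (1 + Real.log n) ^ 2)) ^ 2 / (1944 * (1 + Real.log n) ^ 4)) hτ hη₀ hLB hΦη hηq
        hcol
      exact twoDenseSharp_final _ _ _ _ hG0 h
    · exfalso
      push Not at hrow hcol
      exact twoDense_matching_absurd hn1 hTPP hS0 hT0 hU0 dA dB pC (fun _ _ => rfl) (fun _ _ => rfl)
        hp0 M _ hM hτ0 hτM hKA hKB (fun k => (hrow k).le) (fun i => (hcol i).le) hW34 hΦ'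

end Summit.MatrixMultiplication.MatrixMultiplication.Theorems.PolynomialSlack
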